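import Literature.NumberTheory.Automorphic.ArchParameterTwistNorm
import Literature.NumberTheory.Automorphic.AutomorphicTwistHecke
import Literature.NumberTheory.Automorphic.BaseChangeArchimedeanCentralCharacter
import Literature.NumberTheory.Automorphic.HarishChandraGLTwist
import Literature.NumberTheory.Automorphic.HarishChandraGLParameterOfCharacter
import HarnessLib

/-!
# The infinity type of the twist of an automorphic representation of `GL_n(𝔸_K)` by the inverse
# of its central character (Borel–Jacquet model)

Topic `NumberTheory/Automorphic`; a proof file (theorems only: no definition, no named fact, no
instance). Let `π = W / W'` be an automorphic representation of `GL_n(𝔸_K)` (Borel–Jacquet datum)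
whose centre acts through the Hecke character `ω` (`AutomorphicRepData.exists_centralCharacter`),
and let `π' = π ⊗ (ω⁻¹ ∘ det)` be the twisted datum (`π'.W = (ω⁻¹∘det) · W`,
`exists_automorphicRepData_twist_hecke`). For `n = 2` this is the contragredient `π^∨ ≅ π ⊗ ω⁻¹`
(consumer: the line `top-degree-exact-control` of the crux `SkinnerWilesDefectOne.ProModularOrdinaryClassical`,
stmt-Langlands-12921, where a regular algebraic cuspidal `π₀` on `GL₂` is replaced by the
`L`-algebraic `π₀^∨ ⊗ |det|^{1/2}`).

* `HasHCParameter.of_add_complex_mul_one` — Harish-Chandra parameters under `ρ ↦ ρ + s δ · 1`,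
  `δ` real killing brackets, `s ∈ ℂ` (independent copy of the concurrent `of_add_cmul_one`).
* `scalar_det_ofArch_expMem` — in `GL_n(𝔸_K)`, `det(exp X, 1) · 1ₙ = (exp (tr X · 1ₙ), 1)`.
* `centralCharacter_det_ofArch_expMem` — **the central character on archimedean exponentials**:
  if the central `tr X · 1ₙ ∈ 𝔤` acts on `W / W'` by the scalar `d`, then `ω(det (exp X, 1)) = e^{d}`
  (`rightTranslation_expMem_scalar_sub_exp_smul_mem`).
* `AutomorphicRepData.lieRep_mulChar_twist_of_exp` — the Lie algebra acts on a twist `π ⊗ c` by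
  `X ↦ X + δ(X)` along `W / W' ≃ W·c / W'·c`, for every character `c` of `GL_n(𝔸_K)` with
  `c (exp X, 1) = e^{δ(X)}` (the norm case is `lieRep_mulChar_twist`).
* `AutomorphicRepData.archDifferential_centralInv_eq` — the differential `δ` of `ω⁻¹ ∘ det` on a line
  `ℝ X` is minus the scalar by which `tr X · 1ₙ` acts; with `HasHCParameter.apply_smul_one`
  (`x · 1ₙ` acts by `∑_σ σ(x) ∑ χ(σ)`), `δ` is `Y ↦ -(∑ χ(σ_w)) tr Y` on a real place factor and
  `Y ↦ -(A tr Y + A' conj(tr Y))`, `A = ∑ χ(σ_w)`, `A' = ∑ χ(σ̄_w)`, on a complex one.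
* `AutomorphicRepData.HasArchParameter.of_map_mulChar_detTwist_centralInv` — **if `π` has
  archimedean parameter `χ` then `π'` has archimedean parameter `σ ↦ χ(σ) - ∑ χ(σ)`** (place by
  place, `HasHCParameter.of_add_complex_mul_one` with the real forms
  `tr`, `re tr`, `im tr`).
* `AutomorphicRepData.IsRegularAlgebraic.of_map_mulChar_detTwist_centralInv` — **if `π` is regular
  algebraic (Clozel) then so is `π'`**, with infinity type `σ ↦ {(a - A_σ, b - A_σ̄)}`,
  `A_σ = ∑_i a_{σ,i} ∈ ℤ` (the `a`'s lie in `(n-1)/2 + ℤ` and `n(n-1)/2 ∈ ℤ`).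

## References

* A. Borel, H. Jacquet, *Automorphic forms and automorphic representations*, Corvallis 1979, 4.6
  and 5.7. [BorelJacquet1979]
* L. Clozel, *Motifs et formes automorphes* (1990), §1 (contragredient, twists), §3.3, Déf. 1.8,
  3.12. [Clozel1990]
* A. W. Knapp, *Lie Groups Beyond an Introduction* (2002), Thm. 5.44. [Knapp2002]
-/

-- Mathlib idiom (Mathlib/Algebra/Lie/OfAssociative.lean): the commutator bracket on associative rings
attribute [local instance 100] LieRing.ofAssociativeRing

open scoped MatrixGroups Matrix Classical ComplexConjugate
open NumberField NumberField.InfinitePlace NumberField.mixedEmbedding IsDedekindDomain NormedSpace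

noncomputable section

namespace Literature.NumberTheory.Automorphic

open Literature.NumberTheory.GaloisRepresentations (HeckeCharacter ideleGroup)

/-! ### Harish-Chandra parameters under the twist by a COMPLEX multiple of a real scalar character

(The same statement, `HasHCParameter.of_add_cmul_one`, was landed concurrently in
`HarishChandraGLTwistComplex` by another agent while this file was written; that module was not yet
built on the Lean farm, so an independent proof with distinct names is kept here — librarian: dedupe.)
The tree's `HasHCParameter.of_add_smul_one` (`HarishChandraGLTwist`) twists by a REAL form `δ`; the
differential of a unitary character at a complex place is imaginary, so we need `ρ' = ρ + s δ · 1`,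
`s ∈ ℂ`: the family `Y ↦ ρ Y + δ(Y) t` is ONE Lie homomorphism into `(End V)[t]`, the centre acts in
`ρ + μ δ` by an `(End V)`-valued polynomial in `μ` which is the scalar `γ(z)(l + μ c)` for real `μ`
(`of_add_smul_one`), hence for all `μ` (a complex polynomial vanishing on `ℝ` vanishes), and the
Harish-Chandra homomorphism is unique (`harishChandraHomGL_unique_holds`) with symmetric values. -/

section ComplexShift

variable {𝕜 : Type*} [RCLike 𝕜] {n : ℕ} {V : Type*} [AddCommGroup V] [Module ℂ V]

/-! ### Scalar-valued polynomials with endomorphism coefficients -/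

/-- `algebraMap ℝ (End_ℂ V) r = algebraMap ℂ (End_ℂ V) r` (the real structure of `End_ℂ V` is the
restriction of the complex one). [folklore] -/
theorem cmulTwist_algebraMap_real_end (r : ℝ) :
    algebraMap ℝ (Module.End ℂ V) r = algebraMap ℂ (Module.End ℂ V) (r : ℂ) := by
  refine LinearMap.ext fun v => ?_
  rw [Module.algebraMap_end_apply, Module.algebraMap_end_apply, Complex.coe_smul]

/-- **An `End V`-valued polynomial which is a scalar polynomial on `ℝ` is that scalar polynomial
on `ℂ`.** If `P ∈ (End_ℂ V)[t]` evaluates at `t · 1` to the scalar `p(t)` for every real `t`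
(`p ∈ ℂ[t]`), then it evaluates at `μ · 1` to `p(μ)` for every `μ ∈ ℂ`: for `v ∈ V` and a linear
functional `f`, `t ↦ f(P(t) v) - p(t) f(v)` is a complex polynomial vanishing on `ℝ`, hence zero, and
linear functionals separate the points of `V`. [folklore] -/
theorem cmulTwist_eval₂_algebraMap_eq_of_forall_real {P : Polynomial (Module.End ℂ V)} {p : Polynomial ℂ}
    (h : ∀ t : ℝ, Polynomial.eval₂ (RingHom.id _) (algebraMap ℂ (Module.End ℂ V) (t : ℂ)) P =
      algebraMap ℂ (Module.End ℂ V) (p.eval (t : ℂ))) (μ : ℂ) :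
    Polynomial.eval₂ (RingHom.id _) (algebraMap ℂ (Module.End ℂ V) μ) P =
      algebraMap ℂ (Module.End ℂ V) (p.eval μ) := by
  classical
  -- the evaluation at `μ · 1`, coefficientwise
  have heval : ∀ (ν : ℂ) (v : V), Polynomial.eval₂ (RingHom.id _) (algebraMap ℂ (Module.End ℂ V) ν) P v =
      ∑ i ∈ Finset.range (P.natDegree + 1), ν ^ i • P.coeff i v := by
    intro ν v
    rw [Polynomial.eval₂_eq_sum_range, LinearMap.sum_apply]
    refine Finset.sum_congr rfl fun i _ => ?_
    rw [RingHom.id_apply, ← map_pow, Module.End.mul_apply, Module.algebraMap_end_apply, map_smul]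
  refine LinearMap.ext fun v => ?_
  rw [Module.algebraMap_end_apply, ← sub_eq_zero]
  refine (Module.forall_dual_apply_eq_zero_iff ℂ _).mp fun f => ?_
  -- the scalar polynomial `Q(t) = f(P(t) v) - p(t) f(v)`
  set Q : Polynomial ℂ :=
    (∑ i ∈ Finset.range (P.natDegree + 1), Polynomial.C (f (P.coeff i v)) * Polynomial.X ^ i) -
      f v • p with hQ
  have hQeval : ∀ ν : ℂ, Q.eval ν =
      f (Polynomial.eval₂ (RingHom.id _) (algebraMap ℂ (Module.End ℂ V) ν) P v) - Q.eval ν * 0 -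
        p.eval ν * f v := by
    intro ν
    rw [mul_zero, sub_zero, hQ, Polynomial.eval_sub, Polynomial.eval_smul, Polynomial.eval_finsetSum,
      heval, map_sum, smul_eq_mul, mul_comm (f v)]
    congr 1
    refine Finset.sum_congr rfl fun i _ => ?_
    rw [Polynomial.eval_mul, Polynomial.eval_C, Polynomial.eval_pow, Polynomial.eval_X, map_smul,
      smul_eq_mul, mul_comm]
  have hQzero : Q = 0 := by
    refine Polynomial.eq_zero_of_infinite_isRoot Q ?_
    refine Set.Infinite.mono (s := Set.range ((↑) : ℝ → ℂ)) ?_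
      (Set.infinite_range_of_injective Complex.ofReal_injective)
    rintro _ ⟨t, rfl⟩
    change Q.eval (t : ℂ) = 0
    rw [hQeval, h t, Module.algebraMap_end_apply, map_smul, smul_eq_mul, mul_zero, sub_zero, mul_comm,
      sub_self]
  have hμ := hQeval μ
  rw [hQzero, Polynomial.eval_zero, zero_mul, sub_zero] at hμ
  rw [map_sub, map_smul, smul_eq_mul, mul_comm (p.eval μ)]
  linear_combination -hμ

/-! ### The one-parameter family of twists as one Lie homomorphism into `(End V)[t]` -/

/-- **The family `Y ↦ ρ Y + δ(Y) t` is a Lie algebra homomorphism `𝔤𝔩ₙ(𝕜) → (End_ℂ V)[t]`** for a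
real linear form `δ` killing brackets (`t` and the real scalars are central in `(End V)[t]`).
Dixmier, *Enveloping Algebras*, 2.2. [folklore] -/
theorem cmulTwist_exists_lieHom_polynomial (ρ : Matrix (Fin n) (Fin n) 𝕜 →ₗ⁅ℝ⁆ Module.End ℂ V)
    (δ : Matrix (Fin n) (Fin n) 𝕜 →ₗ[ℝ] ℝ) (hδ : ∀ X Y : Matrix (Fin n) (Fin n) 𝕜, δ ⁅X, Y⁆ = 0) :
    ∃ L : Matrix (Fin n) (Fin n) 𝕜 →ₗ⁅ℝ⁆ Polynomial (Module.End ℂ V),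
      ∀ Y, L Y = Polynomial.C (ρ Y) +
        Polynomial.C (algebraMap ℂ (Module.End ℂ V) (δ Y : ℂ)) * Polynomial.X := by
  -- `u_Y = δ(Y) t` is central
  have hcen : ∀ (Y : Matrix (Fin n) (Fin n) 𝕜) (q : Polynomial (Module.End ℂ V)),
      Commute (Polynomial.C (algebraMap ℂ (Module.End ℂ V) (δ Y : ℂ)) * Polynomial.X) q := by
    intro Y q
    refine Commute.mul_left ?_ (Polynomial.commute_X q)
    rw [← Polynomial.algebraMap_apply]
    exact Algebra.commute_algebraMap_left _ q
  refine ⟨{ toFun := fun Y => Polynomial.C (ρ Y) +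
              Polynomial.C (algebraMap ℂ (Module.End ℂ V) (δ Y : ℂ)) * Polynomial.X
            map_add' := fun Y Y' => by
              simp only [map_add, Complex.ofReal_add, add_mul]
              abel
            map_smul' := fun r Y => by
              simp only [RingHom.id_apply]
              have h1 : ρ (r • Y) = r • ρ Y :=
                (ρ : Matrix (Fin n) (Fin n) 𝕜 →ₗ[ℝ] Module.End ℂ V).map_smul r Y
              rw [h1, LinearMap.map_smul, smul_eq_mul, Complex.ofReal_mul, map_mul,
                ← cmulTwist_algebraMap_real_end, ← Algebra.smul_def, smul_add, ← Polynomial.smul_C,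
                ← Polynomial.smul_C, smul_mul_assoc]
            map_lie' := fun {Y Y'} => ?_ }, fun Y => rfl⟩
  have hρ : Polynomial.C (ρ ⁅Y, Y'⁆) =
      Polynomial.C (ρ Y) * Polynomial.C (ρ Y') - Polynomial.C (ρ Y') * Polynomial.C (ρ Y) := by
    rw [LieHom.map_lie, LieRing.of_associative_ring_bracket, map_sub, map_mul, map_mul]
  simp only [hδ, Complex.ofReal_zero, map_zero, zero_mul, add_zero]
  rw [hρ, LieRing.of_associative_ring_bracket]
  have hu := hcen Y
  have hw := hcen Y'
  rw [add_mul, mul_add, mul_add, add_mul, mul_add, mul_add, (hw (Polynomial.C (ρ Y))).eq,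
    (hu (Polynomial.C (ρ Y'))).eq, (hu _).eq]
  abel

/-- **`U(𝔤)` acts in the twist `ρ + μ δ · 1` through `ev_μ ∘ U(L)`**: for every `μ ∈ ℂ` and every
Lie homomorphism `ρ_μ` with `ρ_μ Y = ρ Y + μ δ(Y) · 1`, and every `u ∈ U(𝔤)`,
`U(ρ_μ)(u) = ev_{μ·1}(U(L)(u))` (both are algebra homomorphisms agreeing on `𝔤`).
Dixmier, *Enveloping Algebras*, 2.1.1 and 2.2. [folklore] -/
theorem cmulTwist_lift_eq_eval₂_lift {ρ : Matrix (Fin n) (Fin n) 𝕜 →ₗ⁅ℝ⁆ Module.End ℂ V}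
    {δ : Matrix (Fin n) (Fin n) 𝕜 →ₗ[ℝ] ℝ}
    {L : Matrix (Fin n) (Fin n) 𝕜 →ₗ⁅ℝ⁆ Polynomial (Module.End ℂ V)}
    (hL : ∀ Y, L Y = Polynomial.C (ρ Y) +
      Polynomial.C (algebraMap ℂ (Module.End ℂ V) (δ Y : ℂ)) * Polynomial.X)
    (μ : ℂ) {ρμ : Matrix (Fin n) (Fin n) 𝕜 →ₗ⁅ℝ⁆ Module.End ℂ V}
    (hρμ : ∀ Y, ρμ Y = ρ Y + (μ * (δ Y : ℂ)) • (1 : Module.End ℂ V))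
    (u : UniversalEnvelopingAlgebra ℝ (Matrix (Fin n) (Fin n) 𝕜)) :
    UniversalEnvelopingAlgebra.lift ℝ ρμ u =
      Polynomial.eval₂ (RingHom.id _) (algebraMap ℂ (Module.End ℂ V) μ)
        (UniversalEnvelopingAlgebra.lift ℝ L u) := by
  -- evaluation at the central `μ · 1` as a real algebra homomorphism
  let ev : Polynomial (Module.End ℂ V) →ₐ[ℝ] Module.End ℂ V :=
    { Polynomial.eval₂RingHom' (RingHom.id _) (algebraMap ℂ (Module.End ℂ V) μ)
        (fun a => Algebra.commute_algebraMap_right μ a) with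
      commutes' := fun r => by
        change Polynomial.eval₂ (RingHom.id _) (algebraMap ℂ (Module.End ℂ V) μ)
          (algebraMap ℝ (Polynomial (Module.End ℂ V)) r) = algebraMap ℝ (Module.End ℂ V) r
        rw [Polynomial.algebraMap_apply, Polynomial.eval₂_C, RingHom.id_apply] }
  have hev : ∀ P, ev P = Polynomial.eval₂ (RingHom.id _) (algebraMap ℂ (Module.End ℂ V) μ) P :=
    fun P => rfl
  suffices h : UniversalEnvelopingAlgebra.lift ℝ ρμ = ev.comp (UniversalEnvelopingAlgebra.lift ℝ L) by
    rw [h]; rfl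
  apply _root_.UniversalEnvelopingAlgebra.hom_ext
  refine LieHom.ext fun Y => ?_
  simp only [LieHom.coe_comp, Function.comp_apply, AlgHom.coe_toLieHom, AlgHom.coe_comp]
  rw [UniversalEnvelopingAlgebra.lift_ι_apply, UniversalEnvelopingAlgebra.lift_ι_apply, hρμ, hev, hL,
    Polynomial.eval₂_add, Polynomial.eval₂_mul_X, Polynomial.eval₂_C, Polynomial.eval₂_C,
    RingHom.id_apply, RingHom.id_apply, ← map_mul, Algebra.algebraMap_eq_smul_one, mul_comm]

/-! ### The shift by a complex multiple of a real character -/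

/-- `weightFun` is homogeneous in the weight. [folklore] -/
theorem cmulTwist_weightFun_const_mul (s : ℂ) (c : (𝕜 →ₐ[ℝ] ℂ) → ℂ) (h : Fin n → 𝕜) :
    weightFun (fun τ (_ : Fin n) => s * c τ) h = s * weightFun (fun τ (_ : Fin n) => c τ) h := by
  simp only [weightFun, Finset.mul_sum, mul_assoc]

/-- The value `γ(z)(l + μ c)` is a polynomial in `μ`: `γ(z)(l + μ c) = p_z(μ)` for
`p_z = γ(z)(l_{τ,i} + c_τ t) ∈ ℂ[t]`. [folklore] -/
theorem cmulTwist_aeval_add_mul_eq_eval (q : MvPolynomial ((𝕜 →ₐ[ℝ] ℂ) × Fin n) ℂ)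
    (l : (𝕜 →ₐ[ℝ] ℂ) → Fin n → ℂ) (c : (𝕜 →ₐ[ℝ] ℂ) → ℂ) (μ : ℂ) :
    MvPolynomial.aeval (fun p : (𝕜 →ₐ[ℝ] ℂ) × Fin n => l p.1 p.2 + μ * c p.1) q =
      (MvPolynomial.aeval (fun p : (𝕜 →ₐ[ℝ] ℂ) × Fin n =>
        Polynomial.C (l p.1 p.2) + Polynomial.C (c p.1) * Polynomial.X) q).eval μ := by
  rw [← Polynomial.coe_aeval_eq_eval, ← AlgHom.comp_apply, MvPolynomial.comp_aeval]
  have hfg : (fun p : (𝕜 →ₐ[ℝ] ℂ) × Fin n => l p.1 p.2 + μ * c p.1) =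
      fun p : (𝕜 →ₐ[ℝ] ℂ) × Fin n =>
        Polynomial.aeval μ (Polynomial.C (l p.1 p.2) + Polynomial.C (c p.1) * Polynomial.X) := by
    funext p
    simp only [map_add, map_mul, Polynomial.aeval_C, Polynomial.aeval_X, Algebra.algebraMap_self,
      RingHom.id_apply]
    ring
  rw [hfg]

/-- **Harish-Chandra parameter of the twist by a COMPLEX multiple of a real scalar character.**
Let `δ` be a real linear form on `𝔤𝔩ₙ(𝕜)` vanishing on brackets and on `𝔫` with
`δ(diag h) = ∑_τ c_τ ∑_i τ(h_i)`, let `s ∈ ℂ`, and let `ρ' X = ρ X + s δ(X) · 1`. If `(V, ρ)` has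
Harish-Chandra parameter `χ` then `(V, ρ')` has parameter `τ ↦ χ τ + s c_τ` (every entry at `τ`
shifted by `s c_τ`). For real `s` this is `HasHCParameter.of_add_smul_one`; the complex case follows
because the infinitesimal character of `ρ + μ δ` is, for each central `z`, a polynomial in `μ`
(`cmulTwist_lift_eq_eval₂_lift`) which agrees with the polynomial `γ(z)(l + μ c)` at every real `μ`
(`cmulTwist_eval₂_algebraMap_eq_of_forall_real`). Knapp 2002, Thm. 5.44; Borel–Jacquet 1979, 5.7 (twists
`π ⊗ χ`, `χ` any quasi-character). [cite: Knapp2002, §V.5 Thm. 5.44] -/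
theorem HasHCParameter.of_add_complex_mul_one {δ : Matrix (Fin n) (Fin n) 𝕜 →ₗ[ℝ] ℝ}
    (hδ : ∀ X Y : Matrix (Fin n) (Fin n) 𝕜, δ ⁅X, Y⁆ = 0)
    (hδn : ∀ X ∈ upperNilpLie 𝕜 n, δ X = 0) {c : (𝕜 →ₐ[ℝ] ℂ) → ℂ}
    (hδc : ∀ h : Fin n → 𝕜,
      ((δ (Matrix.diagonal h) : ℝ) : ℂ) = weightFun (fun τ (_ : Fin n) => c τ) h)
    (s : ℂ) {ρ ρ' : Matrix (Fin n) (Fin n) 𝕜 →ₗ⁅ℝ⁆ Module.End ℂ V}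
    (hρ' : ∀ X, ρ' X = ρ X + (s * (δ X : ℂ)) • (1 : Module.End ℂ V))
    {χ : (𝕜 →ₐ[ℝ] ℂ) → Multiset ℂ} (hχ : HasHCParameter ρ χ) :
    HasHCParameter ρ' fun τ => (χ τ).map (· + s * c τ) := by
  classical
  have hcard : ∀ τ, Multiset.card (χ τ) = n := hχ.1
  choose l₀ hl₀ using fun τ => exists_enum_of_card_eq' (χ τ) (hcard τ)
  set γ₀ : HarishChandraHomGL 𝕜 n := harishChandraHomGL 𝕜 n with hγ₀
  obtain ⟨L, hL⟩ := cmulTwist_exists_lieHom_polynomial ρ δ hδ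
  -- the scalar polynomial `p_z(μ) = γ₀(z)(l₀ + μ c)`
  let pz : Subalgebra.center ℝ (UniversalEnvelopingAlgebra ℝ (Matrix (Fin n) (Fin n) 𝕜)) → Polynomial ℂ :=
    fun z => MvPolynomial.aeval (fun p : (𝕜 →ₐ[ℝ] ℂ) × Fin n =>
      Polynomial.C (l₀ p.1 p.2) + Polynomial.C (c p.1) * Polynomial.X) (γ₀.toAlgHom z)
  have hpz : ∀ z (μ : ℂ), MvPolynomial.aeval (fun p : (𝕜 →ₐ[ℝ] ℂ) × Fin n => l₀ p.1 p.2 + μ * c p.1)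
      (γ₀.toAlgHom z) = (pz z).eval μ := fun z μ => cmulTwist_aeval_add_mul_eq_eval _ l₀ c μ
  -- REAL twists: the centre acts by `p_z(t)`
  have hreal : ∀ (t : ℝ) (z : Subalgebra.center ℝ (UniversalEnvelopingAlgebra ℝ (Matrix (Fin n) (Fin n) 𝕜))),
      Polynomial.eval₂ (RingHom.id _) (algebraMap ℂ (Module.End ℂ V) (t : ℂ))
          (UniversalEnvelopingAlgebra.lift ℝ L z) =
        algebraMap ℂ (Module.End ℂ V) ((pz z).eval (t : ℂ)) := by
    intro t z
    have hδt : ∀ X Y : Matrix (Fin n) (Fin n) 𝕜, (t • δ) ⁅X, Y⁆ = 0 := fun X Y => by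
      rw [LinearMap.smul_apply, hδ, smul_zero]
    have hδtn : ∀ X ∈ upperNilpLie 𝕜 n, (t • δ) X = 0 := fun X hX => by
      rw [LinearMap.smul_apply, hδn X hX, smul_zero]
    have hδtc : ∀ h : Fin n → 𝕜, (((t • δ) (Matrix.diagonal h) : ℝ) : ℂ) =
        weightFun (fun τ (_ : Fin n) => (t : ℂ) * c τ) h := fun h => by
      rw [LinearMap.smul_apply, smul_eq_mul, Complex.ofReal_mul, hδc, cmulTwist_weightFun_const_mul]
    obtain ⟨ρt, hρt⟩ := exists_lieHom_add_real_smul_one ρ (t • δ) hδt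
    obtain ⟨-, θt, hθt, hθtγ⟩ := HasHCParameter.of_add_smul_one hδt hδtn hδtc hρt hχ
    have hρt' : ∀ Y, ρt Y = ρ Y + ((t : ℂ) * (δ Y : ℂ)) • (1 : Module.End ℂ V) := fun Y => by
      rw [hρt, LinearMap.smul_apply, smul_eq_mul, Complex.ofReal_mul]
    have henum : ∀ τ, Finset.univ.val.map (fun i => l₀ τ i + (t : ℂ) * c τ) =
        (χ τ).map (· + (t : ℂ) * c τ) := fun τ => by
      rw [← hl₀ τ, Multiset.map_map]; rfl
    have h1 := cmulTwist_lift_eq_eval₂_lift hL (t : ℂ) hρt'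
      (z : UniversalEnvelopingAlgebra ℝ (Matrix (Fin n) (Fin n) 𝕜))
    have h2 : UniversalEnvelopingAlgebra.lift ℝ ρt
        (z : UniversalEnvelopingAlgebra ℝ (Matrix (Fin n) (Fin n) 𝕜)) =
          algebraMap ℂ (Module.End ℂ V) (θt z) := hθt z
    have h3 := hθtγ γ₀ (fun τ i => l₀ τ i + (t : ℂ) * c τ) henum z
    rw [← h1, h2, h3, hpz]
  -- hence the centre acts in `ρ'` by `p_z(s)`
  have hs : ∀ z : Subalgebra.center ℝ (UniversalEnvelopingAlgebra ℝ (Matrix (Fin n) (Fin n) 𝕜)),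
      UniversalEnvelopingAlgebra.lift ℝ ρ' z = algebraMap ℂ (Module.End ℂ V) ((pz z).eval s) := fun z => by
    rw [cmulTwist_lift_eq_eval₂_lift hL s hρ' z]
    exact cmulTwist_eval₂_algebraMap_eq_of_forall_real (fun t => hreal t z) s
  -- the infinitesimal character `θ' = ev_{l₀ + s c} ∘ γ₀`
  let θ' : Subalgebra.center ℝ (UniversalEnvelopingAlgebra ℝ (Matrix (Fin n) (Fin n) 𝕜)) →ₐ[ℝ] ℂ :=
    ((MvPolynomial.aeval (R := ℂ)
      (fun p : (𝕜 →ₐ[ℝ] ℂ) × Fin n => l₀ p.1 p.2 + s * c p.1)).restrictScalars ℝ).comp γ₀.toAlgHom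
  have hθ' : ∀ z, θ' z = MvPolynomial.aeval (fun p : (𝕜 →ₐ[ℝ] ℂ) × Fin n => l₀ p.1 p.2 + s * c p.1)
      (γ₀.toAlgHom z) := fun z => rfl
  refine ⟨fun τ => by rw [Multiset.card_map, hcard], θ', fun z => ?_, fun γ l hl z => ?_⟩
  · rw [hs z, hθ', hpz]
  · obtain rfl : γ = γ₀ := harishChandraHomGL_unique_holds γ γ₀
    rw [hθ']
    refine aeval_eq_aeval_of_map_univ_eq (l := fun τ i => l₀ τ i + s * c τ) (l' := l)
      (γ₀.toAlgHom_mem_symmetricSubalgebraGL z) fun τ => ?_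
    rw [hl τ]
    dsimp only
    rw [← hl₀ τ, Multiset.map_map]
    rfl

end ComplexShift

/-! ### The central character on archimedean exponentials -/

section Central

variable {n : ℕ} {K : Type} [Field K] [NumberField K] {hcpt : isCompact_glFiniteIntegralLevel n K}

/-- **`det(exp X, 1) · 1ₙ = (exp(tr X · 1ₙ), 1)` in `GL_n(𝔸_K)`**: the scalar matrix of the idele
`det (exp X, 1)` (archimedean component `det exp X = e^{tr X}`, finite component `1`) is the
archimedean one-parameter value `exp (tr X · 1ₙ)` embedded in `GL_n(𝔸_K)`. [folklore] -/
theorem scalar_det_ofArch_expMem (X : (AutomorphyDatum.gl n K hcpt).arch.lie) :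
    (Matrix.GeneralLinearGroup.scalar (Fin n)
        (Matrix.GeneralLinearGroup.det ((AutomorphyDatum.gl n K hcpt).ofArch
          ((AutomorphyDatum.gl n K hcpt).arch.expMem X))) : (AdelicGroupData.gl n K).Adelic) =
      (AutomorphyDatum.gl n K hcpt).ofArch ((AutomorphyDatum.gl n K hcpt).arch.expMem
        ((1 : ℝ) • (⟨Matrix.scalar (Fin n) ((X : Matrix (Fin n) (Fin n) (mixedSpace K)).trace), trivial⟩ :
          (AutomorphyDatum.gl n K hcpt).arch.lie))) := by
  rw [AutomorphyDatum.gl_ofArch_apply, AutomorphyDatum.gl_ofArch_apply]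
  set g : GL (Fin n) (mixedSpace K) := ((AutomorphyDatum.gl n K hcpt).arch.expMem X :
    GL (Fin n) (mixedSpace K)) with hg
  set z : ideleGroup K := Matrix.GeneralLinearGroup.det (GLn.ofInfinite n K g) with hz
  have e := GLn.ofInfinite_toMixed_mul_ofFinite_sndHom (n := n) (K := K)
    (Matrix.GeneralLinearGroup.scalar (Fin n) z)
  have hsnd : GLn.sndHom n K (Matrix.GeneralLinearGroup.scalar (Fin n) z) = 1 := by
    change Matrix.GeneralLinearGroup.map _ (Matrix.GeneralLinearGroup.scalar (Fin n) z) = 1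
    rw [Matrix.GeneralLinearGroup.map_scalar]
    convert map_one (Matrix.GeneralLinearGroup.scalar (Fin n) :
      (FiniteAdeleRing (𝓞 K) K)ˣ →* GL (Fin n) (FiniteAdeleRing (𝓞 K) K)) using 2
    exact Units.ext (coe_det_ofInfinite_snd g)
  have harch : GLn.toMixed n K (Matrix.GeneralLinearGroup.scalar (Fin n) z) =
      ((AutomorphyDatum.gl n K hcpt).arch.expMem
        ((1 : ℝ) • (⟨Matrix.scalar (Fin n) ((X : Matrix (Fin n) (Fin n) (mixedSpace K)).trace), trivial⟩ :
          (AutomorphyDatum.gl n K hcpt).arch.lie)) : GL (Fin n) (mixedSpace K)) := by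
    refine Units.ext ?_
    rw [coe_toMixed_scalar, coe_expMem_smul_scalar, one_smul, coe_det_ofInfinite_fst,
      RingEquiv.apply_symm_apply, hg, RealMatrixGroup.coe_expMem, coe_expGL,
      Literature.Analysis.Matrix.det_exp_eq_exp_trace]
  rw [hsnd, map_one, mul_one, harch] at e
  exact e.symm

/-- Scalars by which an operator acts on `W / W'` are unique (`W' ≠ W`): deprecated alias of the
submodule lemma `eq_of_sub_smul_mem_of_not_mem` (`AutomorphicRepsGLSatakeProofs`), which the proof
below uses directly. The former `π.W'`-specialised restatement under this name had no users and was
flagged three times by the duplicate probe (librarian dedup-01608, dedup-02361, dedup-02630), so the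
name now denotes the general lemma itself. [folklore] -/
@[deprecated eq_of_sub_smul_mem_of_not_mem (since := "2026-08-16")]
alias AutomorphicRepData.eq_of_sub_smul_mem_of_sub_smul_mem := eq_of_sub_smul_mem_of_not_mem

/-- **The central character on archimedean exponentials.** Let `π = W / W'` be an automorphic
representation of `GL_n(𝔸_K)` on which the centre `Z(𝔸_K)` acts through the Hecke character `ω`
(`r(z · 1ₙ) φ - ω(z) φ ∈ W'`, `AutomorphicRepData.exists_centralCharacter`), and suppose the
central `tr X · 1ₙ ∈ 𝔤` (`X ∈ 𝔤𝔩ₙ(K_∞)`) acts on `W / W'` by the scalar `d`. Then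
`ω(det (exp X, 1)) = e^{d}`: `det (exp X, 1) · 1ₙ = exp (tr X · 1ₙ)`
(`scalar_det_ofArch_expMem`), which acts on `W / W'` by `e^{d}`
(`rightTranslation_expMem_scalar_sub_exp_smul_mem`). Borel–Jacquet 1979, 4.6 and 5.7.
[cite: BorelJacquet1979, 5.7] -/
theorem centralCharacter_det_ofArch_expMem {π : AutomorphicRepData (AutomorphyDatum.gl n K hcpt)}
    {ω : HeckeCharacter K} (hω : ∀ (z : ideleGroup K), ∀ φ ∈ π.W,
      rightTranslation (AdelicGroupData.gl n K) (Matrix.GeneralLinearGroup.scalar (Fin n) z) φ -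
        ((ω z : ℂˣ) : ℂ) • φ ∈ π.W')
    (X : (AutomorphyDatum.gl n K hcpt).arch.lie) {d : ℂ}
    (hd : ∀ φ ∈ π.W, lieDeriv (AutomorphyDatum.gl n K hcpt).ofArch
      (⟨Matrix.scalar (Fin n) ((X : Matrix (Fin n) (Fin n) (mixedSpace K)).trace), trivial⟩ :
        (AutomorphyDatum.gl n K hcpt).arch.lie) φ - d • φ ∈ π.W') :
    ((ω (Matrix.GeneralLinearGroup.det ((AutomorphyDatum.gl n K hcpt).ofArch
        ((AutomorphyDatum.gl n K hcpt).arch.expMem X))) : ℂˣ) : ℂ) = Complex.exp d := by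
  obtain ⟨ψ, hψW, hψW'⟩ := SetLike.exists_of_lt π.lt
  have h1 := hω (Matrix.GeneralLinearGroup.det ((AutomorphyDatum.gl n K hcpt).ofArch
    ((AutomorphyDatum.gl n K hcpt).arch.expMem X))) ψ hψW
  have h2 := π.rightTranslation_expMem_scalar_sub_exp_smul_mem _ hd 1 hψW
  rw [Complex.ofReal_one, mul_one, ← scalar_det_ofArch_expMem X] at h2
  exact eq_of_sub_smul_mem_of_not_mem h1 h2 hψW'

end Central

/-! ### The Lie algebra action on a twist by a character with a differential -/

namespace AutomorphicRepData

variable {n : ℕ} {K : Type} [Field K] [NumberField K] {hcpt : isCompact_glFiniteIntegralLevel n K}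

/-- **The Lie algebra acts on the twist `π ⊗ c` by `X ↦ X + δ(X)`**: let `c` be a character of
`GL_n(𝔸_K)` with `c (exp X, 1) = e^{δ(X)}` for a real-linear `δ : 𝔤𝔩ₙ(K_∞) → ℂ`, and `π'` the
twisted datum (`π'.W = c · W`, `π'.W' = c · W'`) with quotient isomorphism `e : W/W' ≃ W·c/W'·c`
(`exists_quotEquiv_of_map_mulChar`) and Lie action `ρ` of `π`. Then
`π'.lieRep X (e v) = e (ρ X v + δ(X) v)`, since `X (c φ) = c (X φ + δ(X) φ)`
(`lieDeriv_mulChar_of_exp`). The case `c = |det|^s` is `lieRep_mulChar_twist`.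
Borel–Jacquet 1979, §1.5, 4.6 and 5.7. [cite: BorelJacquet1979, 5.7] -/
theorem lieRep_mulChar_twist_of_exp {c : (AdelicGroupData.gl n K).Adelic →* ℂˣ}
    {δ : (AutomorphyDatum.gl n K hcpt).arch.lie →ₗ[ℝ] ℂ}
    (hc : ∀ X : (AutomorphyDatum.gl n K hcpt).arch.lie,
      (c ((AutomorphyDatum.gl n K hcpt).ofArch ((AutomorphyDatum.gl n K hcpt).arch.expMem X)) : ℂ) =
        Complex.exp (δ X))
    {π π' : AutomorphicRepData (AutomorphyDatum.gl n K hcpt)}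
    (hW : π'.W = π.W.map (mulChar c)) {e : π.Quot ≃ₗ[ℂ] π'.Quot}
    (he : ∀ φ : π.W, e (π.mkQ φ) = π'.mkQ ⟨mulChar c φ, hW ▸ Submodule.mem_map_of_mem φ.2⟩)
    {ρ : (AutomorphyDatum.gl n K hcpt).arch.lie →ₗ⁅ℝ⁆ Module.End ℂ π.Quot} (hρ : π.HasLieAction ρ)
    (X : (AutomorphyDatum.gl n K hcpt).arch.lie) (v : π.Quot) :
    π'.lieRep X (e v) = e (ρ X v + δ X • v) := by
  haveI : FiniteDimensional ℝ (mixedSpace K) := inferInstance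
  induction v using Submodule.Quotient.induction_on with
  | H φ =>
  have hmk : (Submodule.Quotient.mk φ : π.Quot) = π.mkQ φ := rfl
  have hmem : ∀ ψ : π.W, mulChar c ψ ∈ π'.W := fun ψ => hW ▸ Submodule.mem_map_of_mem ψ.2
  have hL : π'.lieRep X (e (π.mkQ φ)) = π'.mkQ (π'.lieDerivW X ⟨mulChar c φ, hmem φ⟩) := by
    rw [he]
    exact π'.lieRep_mkQ X _
  have h5 : ρ X (π.mkQ φ) + δ X • π.mkQ φ = π.mkQ (π.lieDerivW X φ + δ X • φ) := by
    rw [hρ X φ, (π.mkQ).map_add, (π.mkQ).map_smul]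
  rw [hmk, hL, h5, he]
  congr 1
  refine Subtype.ext ?_
  change lieDeriv (AutomorphyDatum.gl n K hcpt).ofArch X (mulChar c (φ : (AdelicGroupData.gl n K).Adelic → ℂ)) =
    mulChar c ((π.lieDerivW X φ + δ X • φ : π.W) : (AdelicGroupData.gl n K).Adelic → ℂ)
  rw [lieDeriv_mulChar_of_exp _ hc X (π.isArchSmooth_of_mem_W φ.2)]
  rfl

end AutomorphicRepData

/-! ### Place factors: scalar matrices and traces -/

section Places

variable {K : Type*} [Field K] {n : ℕ}

/-- The scalar matrix of the `w`-th coordinate vector of `K_∞` (real `w`) is `ι_w (r · 1ₙ)`.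
[folklore] -/
theorem scalar_single_real (w : {w : InfinitePlace K // IsReal w}) (r : ℝ) :
    Matrix.scalar (Fin n) ((Pi.single w r, 0) : mixedSpace K) =
      realPlaceLie n w (r • (1 : Matrix (Fin n) (Fin n) ℝ)) := by
  ext i j <;> by_cases h : i = j <;>
    simp [Matrix.scalar_apply, realPlaceLie_apply, Matrix.smul_apply, h]

/-- The scalar matrix of the `w`-th coordinate vector of `K_∞` (complex `w`) is `ι_w (z · 1ₙ)`.
[folklore] -/
theorem scalar_single_complex (w : {w : InfinitePlace K // IsComplex w}) (z : ℂ) :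
    Matrix.scalar (Fin n) ((0, Pi.single w z) : mixedSpace K) =
      complexPlaceLie n w (z • (1 : Matrix (Fin n) (Fin n) ℂ)) := by
  ext i j <;> by_cases h : i = j <;>
    simp [Matrix.scalar_apply, complexPlaceLie_apply, Matrix.smul_apply, h]

end Places

/-! ### The archimedean parameter of `π ⊗ (ω⁻¹ ∘ det)` -/

namespace AutomorphicRepData

variable {n : ℕ} {K : Type} [Field K] [NumberField K] {hcpt : isCompact_glFiniteIntegralLevel n K}

/-- **The Lie derivative along an element acting by a scalar through the Lie action**: if
`ρ Z = d · 1` on `W / W'` then `Z φ - d φ ∈ W'` for `φ ∈ W`. [folklore] -/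
theorem HasLieAction.lieDeriv_sub_smul_mem {π : AutomorphicRepData (AutomorphyDatum.gl n K hcpt)}
    {ρ : (AutomorphyDatum.gl n K hcpt).arch.lie →ₗ⁅ℝ⁆ Module.End ℂ π.Quot} (hρ : π.HasLieAction ρ)
    {Z : (AutomorphyDatum.gl n K hcpt).arch.lie} {d : ℂ}
    (hZ : ρ Z = algebraMap ℂ (Module.End ℂ π.Quot) d) :
    ∀ φ ∈ π.W, lieDeriv (AutomorphyDatum.gl n K hcpt).ofArch Z φ - d • φ ∈ π.W' := by
  intro φ hφ
  have h2 := hρ Z ⟨φ, hφ⟩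
  rw [hZ, Module.algebraMap_end_apply] at h2
  have h4 : π.mkQ (π.lieDerivW Z ⟨φ, hφ⟩ - d • ⟨φ, hφ⟩) = 0 := by
    rw [map_sub, map_smul, ← h2, sub_self]
  exact (Submodule.Quotient.mk_eq_zero π.kerQuot).1 h4

/-- **The archimedean differential of `ω⁻¹ ∘ det` on a central line.** Let the centre of
`GL_n(𝔸_K)` act on `π = W / W'` through `ω`, let `δ` be the archimedean differential of
`ω⁻¹ ∘ det` (`(ω⁻¹∘det)(exp X, 1) = e^{δ(X)}`), and let `X ∈ 𝔤` be such that the central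
`tr(tX) · 1ₙ` acts on `W / W'` by `t d` for all real `t`. Then `δ(X) = -d`.
[cite: BorelJacquet1979, 5.7] -/
theorem archDifferential_centralInv_eq {π : AutomorphicRepData (AutomorphyDatum.gl n K hcpt)}
    {ω : HeckeCharacter K}
    (hω : ∀ (z : ideleGroup K), ∀ φ ∈ π.W,
      rightTranslation (AdelicGroupData.gl n K) (Matrix.GeneralLinearGroup.scalar (Fin n) z) φ -
        ((ω z : ℂˣ) : ℂ) • φ ∈ π.W')
    {δ : (AutomorphyDatum.gl n K hcpt).arch.lie →ₗ[ℝ] ℂ}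
    (hδ : ∀ X : (AutomorphyDatum.gl n K hcpt).arch.lie,
      ((detTwist n ω⁻¹ ((AutomorphyDatum.gl n K hcpt).ofArch
        ((AutomorphyDatum.gl n K hcpt).arch.expMem X)) : ℂˣ) : ℂ) = Complex.exp (δ X))
    (X : (AutomorphyDatum.gl n K hcpt).arch.lie) {d : ℂ}
    (hd : ∀ t : ℝ, ∀ φ ∈ π.W, lieDeriv (AutomorphyDatum.gl n K hcpt).ofArch
      (⟨Matrix.scalar (Fin n) (((t • X : (AutomorphyDatum.gl n K hcpt).arch.lie) :
          Matrix (Fin n) (Fin n) (mixedSpace K)).trace), trivial⟩ :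
        (AutomorphyDatum.gl n K hcpt).arch.lie) φ - ((t : ℂ) * d) • φ ∈ π.W') :
    δ X = -d := by
  refine eq_of_forall_exp_mul_eq fun t => ?_
  have h1 := hδ (t • X)
  rw [map_smul, Complex.real_smul, mul_comm] at h1
  rw [← h1, detTwist_apply, GaloisRepresentations.HeckeCharacter.inv_apply, Units.val_inv_eq_inv_val,
    centralCharacter_det_ofArch_expMem hω (t • X) (hd t), ← Complex.exp_neg]
  congr 1
  ring

/-- `-(z A + z̄ A') = -(A + A') re z - i (A - A') im z`. [folklore] -/
private theorem neg_mul_add_conj_mul (z A A' : ℂ) :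
    -(z * A + conj z * A') = -(A + A') * (z.re : ℂ) + -(Complex.I * (A - A')) * (z.im : ℂ) := by
  apply Complex.ext <;> simp <;> ring

/-- `im z = (-i/2) z + (i/2) z̄`. [folklore] -/
private theorem im_eq_combination (z : ℂ) :
    (z.im : ℂ) = -Complex.I / 2 * z + - -Complex.I / 2 * conj z := by
  apply Complex.ext <;> simp <;> ring

-- Budget: ≈ 400 000 heartbeats measured synchronously (`set_option Elab.async false` +
-- `#count_heartbeats in`): the unifications between the place-factor Lie algebra `𝔤𝔩ₙ(K_w)` inside
-- `𝔤 = ⊤ ≤ 𝔤𝔩ₙ(K_∞)` and the abstract `𝔤𝔩ₙ(𝕜)`-module lemmas are instance-heavy; doubled budget.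
set_option maxHeartbeats 800000 in
/-- **Real place.** With the notation of `HasArchParameter.of_map_mulChar_detTwist_centralInv`: if
the factor `𝔤𝔩ₙ(ℝ) = 𝔤𝔩ₙ(K_w)` acts on `W / W'` (through `ρ`, restricted: `ρw`) with
Harish-Chandra parameter `χ_w`, then it acts on the twist `π ⊗ (ω⁻¹∘det)` (`ρw'`) with parameter
`χ_w - ∑ χ_w`: the differential of `ω⁻¹ ∘ det` on the factor is `Y ↦ -(∑ χ_w) tr Y`
(`archDifferential_centralInv_eq`, `HasHCParameter.apply_smul_one`), a complex multiple of the
real form `tr` (`HasHCParameter.of_add_complex_mul_one`).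
[cite: BorelJacquet1979, 5.7] [cite: Knapp2002, §V.5 Thm. 5.44] -/
theorem hasHCParameter_realPlace_centralInv_twist
    {π π' : AutomorphicRepData (AutomorphyDatum.gl n K hcpt)} {ω : HeckeCharacter K}
    (hω : ∀ (z : ideleGroup K), ∀ φ ∈ π.W,
      rightTranslation (AdelicGroupData.gl n K) (Matrix.GeneralLinearGroup.scalar (Fin n) z) φ -
        ((ω z : ℂˣ) : ℂ) • φ ∈ π.W')
    {δ : (AutomorphyDatum.gl n K hcpt).arch.lie →ₗ[ℝ] ℂ}
    (hδ : ∀ X : (AutomorphyDatum.gl n K hcpt).arch.lie,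
      ((detTwist n ω⁻¹ ((AutomorphyDatum.gl n K hcpt).ofArch
        ((AutomorphyDatum.gl n K hcpt).arch.expMem X)) : ℂˣ) : ℂ) = Complex.exp (δ X))
    {ρ : (AutomorphyDatum.gl n K hcpt).arch.lie →ₗ⁅ℝ⁆ Module.End ℂ π.Quot} (hρ : π.HasLieAction ρ)
    {e : π.Quot ≃ₗ[ℂ] π'.Quot}
    (hrel : ∀ (X : (AutomorphyDatum.gl n K hcpt).arch.lie) (v : π.Quot),
      π'.lieRep X (e v) = e (ρ X v + δ X • v))
    (w : {w : InfinitePlace K // IsReal w})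
    {ρw : Matrix (Fin n) (Fin n) ℝ →ₗ⁅ℝ⁆ Module.End ℂ π.Quot}
    (hρw : ∀ Y, ρw Y = ρ ⟨realPlaceLie n w Y, trivial⟩)
    {ρw' : Matrix (Fin n) (Fin n) ℝ →ₗ⁅ℝ⁆ Module.End ℂ π'.Quot}
    (hρw' : ∀ Y, ρw' Y = π'.lieRep ⟨realPlaceLie n w Y, trivial⟩)
    {χw : Multiset ℂ} (hpar : HasHCParameter ρw fun _ => χw) :
    HasHCParameter ρw' fun _ => χw.map (· - χw.sum) := by
  obtain ⟨A, hA⟩ : ∃ A : ℂ, A = χw.sum := ⟨_, rfl⟩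
  -- the central `r · 1ₙ` of the factor acts by `r A`
  have hsc : ∀ r : ℝ, ρw (r • 1) = algebraMap ℂ (Module.End ℂ π.Quot) ((r : ℂ) * A) := fun r => by
    rw [hpar.apply_smul_one r, Fintype.sum_subsingleton _ (Algebra.ofId ℝ ℂ), Algebra.ofId_apply,
      Complex.coe_algebraMap, hA]
  -- `δ` on the factor
  have hδw : ∀ (Y : Matrix (Fin n) (Fin n) ℝ) (X : (AutomorphyDatum.gl n K hcpt).arch.lie),
      (X : Matrix (Fin n) (Fin n) (mixedSpace K)) = realPlaceLie n w Y →
        δ X = -((Y.trace : ℂ) * A) := by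
    intro Y X hXY
    refine archDifferential_centralInv_eq hω hδ X fun t => hρ.lieDeriv_sub_smul_mem ?_
    have hX : (⟨Matrix.scalar (Fin n) (((t • X : (AutomorphyDatum.gl n K hcpt).arch.lie) :
          Matrix (Fin n) (Fin n) (mixedSpace K)).trace), trivial⟩ :
        (AutomorphyDatum.gl n K hcpt).arch.lie) = ⟨realPlaceLie n w ((t * Y.trace) • 1), trivial⟩ := by
      apply Subtype.ext
      change Matrix.scalar (Fin n) ((t • (X : Matrix (Fin n) (Fin n) (mixedSpace K))).trace) =
        realPlaceLie n w ((t * Y.trace) • 1)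
      have hsm : t • realPlaceLie n w Y = realPlaceLie n w (t • Y) :=
        ((realPlaceLie n w : Matrix (Fin n) (Fin n) ℝ →ₗ[ℝ]
          Matrix (Fin n) (Fin n) (mixedSpace K)).map_smul t Y).symm
      rw [hXY, hsm, trace_realPlaceLie, Matrix.trace_smul, smul_eq_mul, scalar_single_real]
    rw [hX, ← hρw, hsc, Complex.ofReal_mul, mul_assoc]
  -- the shifted action on the factor and its parameter
  have hbr : ∀ Y Y' : Matrix (Fin n) (Fin n) ℝ, Matrix.traceLinearMap (Fin n) ℝ ℝ ⁅Y, Y'⁆ = 0 :=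
    fun Y Y' => by
      rw [Matrix.traceLinearMap_apply, LieRing.of_associative_ring_bracket, Matrix.trace_sub,
        Matrix.trace_mul_comm, sub_self]
  obtain ⟨δ₁, hδ₁⟩ : ∃ δ₁ : Matrix (Fin n) (Fin n) ℝ →ₗ[ℝ] ℂ,
      ∀ Y, δ₁ Y = (-A) * ((Matrix.traceLinearMap (Fin n) ℝ ℝ Y : ℝ) : ℂ) :=
    ⟨(-A) • (Complex.ofRealAm.toLinearMap.comp (Matrix.traceLinearMap (Fin n) ℝ ℝ)), fun Y => by
      rw [LinearMap.smul_apply, smul_eq_mul]; rfl⟩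
  have hδ₁br : ∀ Y Y' : Matrix (Fin n) (Fin n) ℝ, δ₁ ⁅Y, Y'⁆ = 0 := fun Y Y' => by
    rw [hδ₁, hbr, Complex.ofReal_zero, mul_zero]
  obtain ⟨ρw₁, hρw₁⟩ := exists_lieHom_add_smul_one ρw δ₁ hδ₁br
  have hρw₁' : ∀ Y, ρw₁ Y = ρw Y + ((-A) * ((Matrix.traceLinearMap (Fin n) ℝ ℝ Y : ℝ) : ℂ)) •
      (1 : Module.End ℂ π.Quot) := fun Y => by rw [hρw₁ Y, hδ₁]
  have hδn : ∀ Y ∈ upperNilpLie ℝ n, Matrix.traceLinearMap (Fin n) ℝ ℝ Y = 0 := fun Y hY => by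
    have hY' : ∀ i j : Fin n, j ≤ i → Y i j = 0 := hY
    have htr : Y.trace = 0 := Finset.sum_eq_zero fun i _ => hY' i i le_rfl
    rw [Matrix.traceLinearMap_apply, htr]
  have hδc : ∀ hh : Fin n → ℝ, ((Matrix.traceLinearMap (Fin n) ℝ ℝ (Matrix.diagonal hh) : ℝ) : ℂ) =
      weightFun (fun (_ : ℝ →ₐ[ℝ] ℂ) (_ : Fin n) => (1 : ℂ)) hh := fun hh => by
    rw [Matrix.traceLinearMap_apply, weightFun_const, Matrix.trace_diagonal,
      HCEmb.card_algHom_of_I_eq_zero (𝕜 := ℝ) (by simp), Nat.cast_one, one_mul, one_mul,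
      RCLike.re_to_real]
  have hpar₁ := HasHCParameter.of_add_complex_mul_one hbr hδn hδc (-A) hρw₁' hpar
  have hfun : (fun _ : ℝ →ₐ[ℝ] ℂ => χw.map (· + -A * 1)) = fun _ => χw.map (· - χw.sum) := by
    funext τ; rw [mul_one, hA]; rfl
  rw [hfun] at hpar₁
  refine HasHCParameter.of_conj e (fun Y v => ?_) hpar₁
  rw [hρw', hrel, hρw₁', hρw, hδw Y ⟨realPlaceLie n w Y, trivial⟩ rfl, LinearMap.add_apply,
    LinearMap.smul_apply, Module.End.one_apply, Matrix.traceLinearMap_apply, neg_mul, mul_comm A]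

-- Budget: two complex shifts, about twice the real place (same reason); quadrupled budget.
set_option maxHeartbeats 1600000 in
/-- **Complex place.** With the notation of `HasArchParameter.of_map_mulChar_detTwist_centralInv`:
if the factor `𝔤𝔩ₙ(ℂ) = 𝔤𝔩ₙ(K_w)` acts on `W / W'` (`ρw`) with Harish-Chandra parameter `χ_w`
(indexed by `τ ∈ {id, conj}`), then it acts on the twist `π ⊗ (ω⁻¹∘det)` (`ρw'`) with parameter
`τ ↦ χ_w(τ) - ∑ χ_w(τ)`: the differential of `ω⁻¹ ∘ det` on the factor is
`Y ↦ -(A tr Y + A' conj(tr Y))`, `A = ∑ χ_w(id)`, `A' = ∑ χ_w(conj)`, the combination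
`-(A + A') re tr Y - i (A - A') im tr Y` of the real forms `re tr`, `im tr`, whose complex twists
shift the parameter by `-A` on the `id`-copy and `-A'` on the `conj`-copy.
[cite: BorelJacquet1979, 5.7] [cite: Knapp2002, §V.5 Thm. 5.44] -/
theorem hasHCParameter_complexPlace_centralInv_twist
    {π π' : AutomorphicRepData (AutomorphyDatum.gl n K hcpt)} {ω : HeckeCharacter K}
    (hω : ∀ (z : ideleGroup K), ∀ φ ∈ π.W,
      rightTranslation (AdelicGroupData.gl n K) (Matrix.GeneralLinearGroup.scalar (Fin n) z) φ -
        ((ω z : ℂˣ) : ℂ) • φ ∈ π.W')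
    {δ : (AutomorphyDatum.gl n K hcpt).arch.lie →ₗ[ℝ] ℂ}
    (hδ : ∀ X : (AutomorphyDatum.gl n K hcpt).arch.lie,
      ((detTwist n ω⁻¹ ((AutomorphyDatum.gl n K hcpt).ofArch
        ((AutomorphyDatum.gl n K hcpt).arch.expMem X)) : ℂˣ) : ℂ) = Complex.exp (δ X))
    {ρ : (AutomorphyDatum.gl n K hcpt).arch.lie →ₗ⁅ℝ⁆ Module.End ℂ π.Quot} (hρ : π.HasLieAction ρ)
    {e : π.Quot ≃ₗ[ℂ] π'.Quot}
    (hrel : ∀ (X : (AutomorphyDatum.gl n K hcpt).arch.lie) (v : π.Quot),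
      π'.lieRep X (e v) = e (ρ X v + δ X • v))
    (w : {w : InfinitePlace K // IsComplex w})
    {ρw : Matrix (Fin n) (Fin n) ℂ →ₗ⁅ℝ⁆ Module.End ℂ π.Quot}
    (hρw : ∀ Y, ρw Y = ρ ⟨complexPlaceLie n w Y, trivial⟩)
    {ρw' : Matrix (Fin n) (Fin n) ℂ →ₗ⁅ℝ⁆ Module.End ℂ π'.Quot}
    (hρw' : ∀ Y, ρw' Y = π'.lieRep ⟨complexPlaceLie n w Y, trivial⟩)
    {χw : (ℂ →ₐ[ℝ] ℂ) → Multiset ℂ} (hpar : HasHCParameter ρw χw) :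
    HasHCParameter ρw' fun τ => (χw τ).map (· - (χw τ).sum) := by
  obtain ⟨A, hA⟩ : ∃ A : ℂ, A = (χw (AlgHom.id ℝ ℂ)).sum := ⟨_, rfl⟩
  obtain ⟨A', hA'⟩ : ∃ A' : ℂ, A' = (χw (Complex.conjAe : ℂ →ₐ[ℝ] ℂ)).sum := ⟨_, rfl⟩
  have hconj : ∀ x : ℂ, (Complex.conjAe : ℂ →ₐ[ℝ] ℂ) x = conj x := fun x => rfl
  have hsc : ∀ z : ℂ, ρw (z • 1) = algebraMap ℂ (Module.End ℂ π.Quot) (z * A + conj z * A') :=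
    fun z => by
      rw [hpar.apply_smul_one z, sum_algHom_complex, AlgHom.id_apply, hconj, hA, hA']
  have hδw : ∀ (Y : Matrix (Fin n) (Fin n) ℂ) (X : (AutomorphyDatum.gl n K hcpt).arch.lie),
      (X : Matrix (Fin n) (Fin n) (mixedSpace K)) = complexPlaceLie n w Y →
        δ X = -(Y.trace * A + conj Y.trace * A') := by
    intro Y X hXY
    refine archDifferential_centralInv_eq hω hδ X fun t => hρ.lieDeriv_sub_smul_mem ?_
    have hX : (⟨Matrix.scalar (Fin n) (((t • X : (AutomorphyDatum.gl n K hcpt).arch.lie) :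
          Matrix (Fin n) (Fin n) (mixedSpace K)).trace), trivial⟩ :
        (AutomorphyDatum.gl n K hcpt).arch.lie) =
        ⟨complexPlaceLie n w (((t : ℂ) * Y.trace) • 1), trivial⟩ := by
      apply Subtype.ext
      change Matrix.scalar (Fin n) ((t • (X : Matrix (Fin n) (Fin n) (mixedSpace K))).trace) =
        complexPlaceLie n w (((t : ℂ) * Y.trace) • 1)
      have hsm : t • complexPlaceLie n w Y = complexPlaceLie n w (t • Y) :=
        ((complexPlaceLie n w : Matrix (Fin n) (Fin n) ℂ →ₗ[ℝ]
          Matrix (Fin n) (Fin n) (mixedSpace K)).map_smul t Y).symm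
      rw [hXY, hsm, trace_complexPlaceLie, Matrix.trace_smul, Complex.real_smul,
        scalar_single_complex]
    rw [hX, ← hρw, hsc, map_mul, Complex.conj_ofReal]
    congr 1
    ring
  -- real and imaginary parts of the trace
  obtain ⟨trR, htrR⟩ : ∃ trR : Matrix (Fin n) (Fin n) ℂ →ₗ[ℝ] ℝ, ∀ Y, trR Y = Y.trace.re :=
    ⟨Complex.reLm.comp (Matrix.traceLinearMap (Fin n) ℝ ℂ), fun Y => rfl⟩
  obtain ⟨trI, htrI⟩ : ∃ trI : Matrix (Fin n) (Fin n) ℂ →ₗ[ℝ] ℝ, ∀ Y, trI Y = Y.trace.im :=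
    ⟨Complex.imLm.comp (Matrix.traceLinearMap (Fin n) ℝ ℂ), fun Y => rfl⟩
  have htr0 : ∀ Y Y' : Matrix (Fin n) (Fin n) ℂ, Matrix.trace ⁅Y, Y'⁆ = 0 := fun Y Y' => by
    rw [LieRing.of_associative_ring_bracket, Matrix.trace_sub, Matrix.trace_mul_comm, sub_self]
  have hbrR : ∀ Y Y' : Matrix (Fin n) (Fin n) ℂ, trR ⁅Y, Y'⁆ = 0 := fun Y Y' => by
    rw [htrR, htr0, Complex.zero_re]
  have hbrI : ∀ Y Y' : Matrix (Fin n) (Fin n) ℂ, trI ⁅Y, Y'⁆ = 0 := fun Y Y' => by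
    rw [htrI, htr0, Complex.zero_im]
  have hnil : ∀ Y ∈ upperNilpLie ℂ n, Y.trace = 0 := fun Y hY => by
    have hY' : ∀ i j : Fin n, j ≤ i → Y i j = 0 := hY
    exact Finset.sum_eq_zero fun i _ => hY' i i le_rfl
  have hδnR : ∀ Y ∈ upperNilpLie ℂ n, trR Y = 0 := fun Y hY => by
    rw [htrR, hnil Y hY, Complex.zero_re]
  have hδnI : ∀ Y ∈ upperNilpLie ℂ n, trI Y = 0 := fun Y hY => by
    rw [htrI, hnil Y hY, Complex.zero_im]
  have hcard : (Fintype.card (ℂ →ₐ[ℝ] ℂ) : ℂ) = 2 := by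
    rw [HCEmb.card_algHom_of_im_I (𝕜 := ℂ) (by simp), Nat.cast_ofNat]
  have hδcR : ∀ hh : Fin n → ℂ, ((trR (Matrix.diagonal hh) : ℝ) : ℂ) =
      weightFun (fun (_ : ℂ →ₐ[ℝ] ℂ) (_ : Fin n) => (1 / 2 : ℂ)) hh := fun hh => by
    rw [htrR, weightFun_const, Matrix.trace_diagonal, hcard, RCLike.re_eq_complex_re]
    ring
  have hδcI : ∀ hh : Fin n → ℂ, ((trI (Matrix.diagonal hh) : ℝ) : ℂ) =
      weightFun (fun (τ : ℂ →ₐ[ℝ] ℂ) (_ : Fin n) => -(τ Complex.I) / 2) hh := fun hh => by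
    rw [htrI, Matrix.trace_diagonal]
    simp only [weightFun, ← Finset.mul_sum]
    rw [sum_algHom_complex]
    simp only [AlgHom.id_apply, hconj, Complex.conj_I, ← map_sum]
    exact im_eq_combination _
  -- first shift: `re tr`, coefficient `-(A + A')`
  obtain ⟨δ₁, hδ₁⟩ : ∃ δ₁ : Matrix (Fin n) (Fin n) ℂ →ₗ[ℝ] ℂ,
      ∀ Y, δ₁ Y = (-(A + A')) * ((trR Y : ℝ) : ℂ) :=
    ⟨(-(A + A')) • (Complex.ofRealAm.toLinearMap.comp trR), fun Y => by
      rw [LinearMap.smul_apply, smul_eq_mul]; rfl⟩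
  have hδ₁br : ∀ Y Y' : Matrix (Fin n) (Fin n) ℂ, δ₁ ⁅Y, Y'⁆ = 0 := fun Y Y' => by
    rw [hδ₁, hbrR, Complex.ofReal_zero, mul_zero]
  obtain ⟨ρw₁, hρw₁⟩ := exists_lieHom_add_smul_one ρw δ₁ hδ₁br
  have hρw₁' : ∀ Y, ρw₁ Y = ρw Y + ((-(A + A')) * ((trR Y : ℝ) : ℂ)) • (1 : Module.End ℂ π.Quot) :=
    fun Y => by rw [hρw₁ Y, hδ₁]
  have hpar₁ := HasHCParameter.of_add_complex_mul_one hbrR hδnR hδcR (-(A + A')) hρw₁' hpar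
  -- second shift: `im tr`, coefficient `-i (A - A')`
  obtain ⟨δ₂, hδ₂⟩ : ∃ δ₂ : Matrix (Fin n) (Fin n) ℂ →ₗ[ℝ] ℂ,
      ∀ Y, δ₂ Y = (-(Complex.I * (A - A'))) * ((trI Y : ℝ) : ℂ) :=
    ⟨(-(Complex.I * (A - A'))) • (Complex.ofRealAm.toLinearMap.comp trI), fun Y => by
      rw [LinearMap.smul_apply, smul_eq_mul]; rfl⟩
  have hδ₂br : ∀ Y Y' : Matrix (Fin n) (Fin n) ℂ, δ₂ ⁅Y, Y'⁆ = 0 := fun Y Y' => by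
    rw [hδ₂, hbrI, Complex.ofReal_zero, mul_zero]
  obtain ⟨ρw₂, hρw₂⟩ := exists_lieHom_add_smul_one ρw₁ δ₂ hδ₂br
  have hρw₂' : ∀ Y, ρw₂ Y = ρw₁ Y + ((-(Complex.I * (A - A'))) * ((trI Y : ℝ) : ℂ)) •
      (1 : Module.End ℂ π.Quot) := fun Y => by rw [hρw₂ Y, hδ₂]
  have hpar₂ := HasHCParameter.of_add_complex_mul_one hbrI hδnI hδcI (-(Complex.I * (A - A')))
    hρw₂' hpar₁
  -- the total shift at `τ` is `-∑ χ_w(τ)`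
  have hfun : (fun τ : ℂ →ₐ[ℝ] ℂ => ((χw τ).map (· + -(A + A') * (1 / 2))).map
      (· + -(Complex.I * (A - A')) * (-(τ Complex.I) / 2))) =
      fun τ => (χw τ).map (· - (χw τ).sum) := by
    funext τ
    rw [Multiset.map_map]
    refine Multiset.map_congr rfl fun x _ => ?_
    simp only [Function.comp_apply]
    rcases Complex.real_algHom_eq_id_or_conj τ with rfl | rfl
    · rw [AlgHom.id_apply, ← hA]
      linear_combination ((A - A') / 2) * Complex.I_sq
    · rw [hconj, Complex.conj_I, ← hA']
      linear_combination (-(A - A') / 2) * Complex.I_sq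
  rw [hfun] at hpar₂
  refine HasHCParameter.of_conj e (fun Y v => ?_) hpar₂
  rw [hρw', hrel, hρw₂', hρw₁', hρw, hδw Y ⟨complexPlaceLie n w Y, trivial⟩ rfl, LinearMap.add_apply,
    LinearMap.add_apply, LinearMap.smul_apply, LinearMap.smul_apply, Module.End.one_apply, htrR, htrI,
    add_assoc, ← add_smul, neg_mul_add_conj_mul]

set_option maxHeartbeats 400000 in
/-- **The archimedean parameter of the twist by the inverse central character.** Let `π = W / W'`
be an automorphic representation of `GL_n(𝔸_K)` whose centre acts through the Hecke character `ω`,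
and `π'` the twisted datum `π ⊗ (ω⁻¹ ∘ det)` (`π'.W = (ω⁻¹∘det) · W`, `π'.W' = (ω⁻¹∘det) · W'`). If
`π` has archimedean parameter `χ`, then `π'` has archimedean parameter `σ ↦ {x - ∑ χ(σ) : x ∈ χ(σ)}`:
on `ℂˣ ⊆ W_{K_w}` the central character of `π_w` is `z ↦ z^{A_σ} z̄^{A_σ̄}` with `A_σ = ∑ χ(σ)`, and
twisting by its inverse shifts the Langlands parameter `(a_i, b_i) ↦ (a_i - A_σ, b_i - A_σ̄)`.
Borel–Jacquet 1979, 5.7; Clozel 1990, §3.3; Knapp 2002, Thm. 5.44.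
[cite: BorelJacquet1979, 5.7] [cite: Clozel1990, §3.3] -/
theorem HasArchParameter.of_map_mulChar_detTwist_centralInv
    {π π' : AutomorphicRepData (AutomorphyDatum.gl n K hcpt)} {ω : HeckeCharacter K}
    (hω : ∀ (z : ideleGroup K), ∀ φ ∈ π.W,
      rightTranslation (AdelicGroupData.gl n K) (Matrix.GeneralLinearGroup.scalar (Fin n) z) φ -
        ((ω z : ℂˣ) : ℂ) • φ ∈ π.W')
    (hW : π'.W = π.W.map (mulChar (detTwist n ω⁻¹)))
    (hW' : π'.W' = π.W'.map (mulChar (detTwist n ω⁻¹)))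
    {χ : (K →+* ℂ) → Multiset ℂ} (h : π.HasArchParameter χ) :
    π'.HasArchParameter fun σ => (χ σ).map (· - (χ σ).sum) := by
  obtain ⟨ρ, hρ, hreal, hcx⟩ := h
  obtain ⟨δ, -, hδ⟩ := exists_linearMap_detTwist_ofArch_expMem_hecke hcpt ω⁻¹
  obtain ⟨e, he⟩ := exists_quotEquiv_of_map_mulChar (detTwist n ω⁻¹) hW hW'
  have hrel := fun X v => lieRep_mulChar_twist_of_exp hδ hW he hρ X v
  refine ⟨π'.lieRep, π'.hasLieAction_lieRep, fun w => ?_, fun w => ?_⟩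
  · refine hasHCParameter_realPlace_centralInv_twist hω hδ hρ hrel w (fun Y => ?_) (fun Y => ?_)
      (hreal w)
    · rw [LieHom.comp_apply, LieHom.comp_apply]
      exact congrArg ρ (Subtype.ext rfl)
    · rw [LieHom.comp_apply, LieHom.comp_apply]
      exact congrArg π'.lieRep (Subtype.ext rfl)
  · refine hasHCParameter_complexPlace_centralInv_twist hω hδ hρ hrel w (fun Y => ?_) (fun Y => ?_)
      (hcx w)
    · rw [LieHom.comp_apply, LieHom.comp_apply]
      exact congrArg ρ (Subtype.ext rfl)
    · rw [LieHom.comp_apply, LieHom.comp_apply]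
      exact congrArg π'.lieRep (Subtype.ext rfl)

/-! ### Regular algebraic representations stay regular algebraic

(`conj ∘ conj ∘ σ = σ` for a complex embedding `σ` is Mathlib's `star_star σ` —
`ComplexEmbedding.conjugate φ` is `star φ` — and the proofs below use it directly; the former local
restatement `conjugate_conjugate_embedding` was removed as a duplicate, librarian dedup-02753.) -/

omit [NumberField K] in
/-- The `a`-sum of a `C`-algebraic multiset of `n` weights is an integer: each `a` lies in
`(n-1)/2 + ℤ` and `n (n-1)/2 = (n choose 2) ∈ ℤ`. [cite: Clozel1990, Déf. 1.8] -/
theorem exists_int_sum_a_of_isCAlgebraic {T : InfinityType K n} (hwf : T.IsWellFormed)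
    (hC : T.IsCAlgebraic) (σ : K →+* ℂ) : ∃ k : ℤ, ((T σ).map ArchWeight.a).sum = k := by
  -- `∑ a = k + card · (n-1)/2` for every sub-multiset of `C`-algebraic weights
  have key : ∀ s : Multiset ArchWeight, (∀ p ∈ s, ∃ k l : ℤ,
      p.a = k + ((n : ℂ) - 1) / 2 ∧ p.b = l + ((n : ℂ) - 1) / 2) →
      ∃ k : ℤ, (s.map ArchWeight.a).sum = k + (Multiset.card s : ℂ) * (((n : ℂ) - 1) / 2) := by
    intro s
    induction s using Multiset.induction_on with
    | empty => intro _; exact ⟨0, by simp⟩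
    | cons p s ih =>
      intro hs
      obtain ⟨k₀, hk₀⟩ := ih fun q hq => hs q (Multiset.mem_cons_of_mem hq)
      obtain ⟨k, l, hk, -⟩ := hs p (Multiset.mem_cons_self p s)
      refine ⟨k + k₀, ?_⟩
      rw [Multiset.map_cons, Multiset.sum_cons, hk₀, hk, Multiset.card_cons]
      push_cast
      ring
  obtain ⟨k, hk⟩ := key (T σ) (hC σ)
  refine ⟨k + n.choose 2, ?_⟩
  rw [hk, hwf.1 σ, Int.cast_add, Int.cast_natCast, Nat.cast_choose_two]
  ring

/-- **If `π` is regular algebraic, so is its twist by the inverse central character**, with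
infinity type `σ ↦ {(a - A_σ, b - A_σ̄) : (a, b) ∈ T(σ)}`, `A_σ = ∑ a_{σ,i}` (an integer:
`exists_int_sum_a_of_isCAlgebraic`): the exponents stay in `(n-1)/2 + ℤ` and pairwise distinct.
For `n = 2` this is "the contragredient of a regular algebraic cuspidal representation of `GL₂` is
regular algebraic". Clozel 1990, §1 and Déf. 1.8, 3.12; Borel–Jacquet 1979, 5.7.
[cite: Clozel1990, Définitions 1.8 and 3.12] [cite: BorelJacquet1979, 5.7] -/
theorem IsRegularAlgebraic.of_map_mulChar_detTwist_centralInv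
    {π π' : AutomorphicRepData (AutomorphyDatum.gl n K hcpt)} {ω : HeckeCharacter K}
    (hω : ∀ (z : ideleGroup K), ∀ φ ∈ π.W,
      rightTranslation (AdelicGroupData.gl n K) (Matrix.GeneralLinearGroup.scalar (Fin n) z) φ -
        ((ω z : ℂˣ) : ℂ) • φ ∈ π.W')
    (hW : π'.W = π.W.map (mulChar (detTwist n ω⁻¹)))
    (hW' : π'.W' = π.W'.map (mulChar (detTwist n ω⁻¹))) (h : π.IsRegularAlgebraic) :
    π'.IsRegularAlgebraic := by
  obtain ⟨T, ⟨hwf, harch⟩, hC, hreg⟩ := h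
  choose kA hkA using exists_int_sum_a_of_isCAlgebraic hwf hC
  have harch' := HasArchParameter.of_map_mulChar_detTwist_centralInv hω hW hW' harch
  -- the shifted infinity type
  let sh : (K →+* ℂ) → ArchWeight → ArchWeight := fun σ p =>
    { a := p.a - ((T σ).map ArchWeight.a).sum
      b := p.b - ((T (ComplexEmbedding.conjugate σ)).map ArchWeight.a).sum
      exists_int_sub := by
        obtain ⟨m, hm⟩ := p.exists_int_sub
        refine ⟨m - kA σ + kA (ComplexEmbedding.conjugate σ), ?_⟩
        rw [hkA, hkA]
        push_cast
        linear_combination hm }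
  have hsh_a : ∀ σ p, (sh σ p).a = p.a - ((T σ).map ArchWeight.a).sum := fun _ _ => rfl
  have hsh_b : ∀ σ p, (sh σ p).b = p.b - ((T (ComplexEmbedding.conjugate σ)).map ArchWeight.a).sum :=
    fun _ _ => rfl
  let T₁ : InfinityType K n := fun σ => (T σ).map (sh σ)
  have hT₁ : ∀ σ, T₁ σ = (T σ).map (sh σ) := fun _ => rfl
  have hmapa : ∀ σ, (T₁ σ).map ArchWeight.a = ((T σ).map ArchWeight.a).map (· - ((T σ).map ArchWeight.a).sum) :=
    fun σ => by rw [hT₁, Multiset.map_map, Multiset.map_map]; rfl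
  refine ⟨T₁, ⟨⟨fun σ => ?_, fun σ => ?_⟩, ?_⟩, fun σ p hp => ?_, fun σ => ?_⟩
  · rw [hT₁, Multiset.card_map, hwf.1 σ]
  · rw [hT₁, hT₁, hwf.2 σ, Multiset.map_map, Multiset.map_map]
    refine Multiset.map_congr rfl fun p _ => ArchWeight.ext ?_ ?_
    · simp only [Function.comp_apply, hsh_a, hsh_b, ArchWeight.swap_a]
    · simp only [Function.comp_apply, hsh_a, hsh_b, ArchWeight.swap_b, star_star]
  · have e : (fun σ => (T₁ σ).map ArchWeight.a) =
        fun σ => ((T σ).map ArchWeight.a).map (· - ((T σ).map ArchWeight.a).sum) := funext hmapa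
    rw [e]
    exact harch'
  · rw [hT₁, Multiset.mem_map] at hp
    obtain ⟨q, hq, rfl⟩ := hp
    obtain ⟨k, l, hk, hl⟩ := hC σ q hq
    refine ⟨k - kA σ, l - kA (ComplexEmbedding.conjugate σ), ?_, ?_⟩
    · rw [hsh_a, hk, hkA]; push_cast; ring
    · rw [hsh_b, hl, hkA]; push_cast; ring
  · rw [hmapa]
    exact (hreg σ).map fun x y hxy => sub_left_injective hxy

end AutomorphicRepData

end Literature.NumberTheory.Automorphic
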